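import Literature.NumberTheory.Sieve.MoebiusShiftedPrimesMajorArcs
import Literature.NumberTheory.Sieve.MoebiusShiftedPrimesPrimeCharacterSum
import HarnessLib

/-!
# Möbius on shifted primes — status of Proposition 3.4 of Lichtman 2020 (`Lichtman2020_liouvilleMeanSquare`)

Topic `Literature/NumberTheory/Sieve`; companion ("Proofs" sibling) of `MoebiusShiftedPrimesMajorArcs.lean`,
whose named fact `Literature.NumberTheory.Sieve.Lichtman2020_liouvilleMeanSquare` vendors Proposition 3.4
of J. D. Lichtman, *Averages of the Möbius function on shifted primes*, Q. J. Math. 73 (2022) 729–757,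
doi:10.1093/qmath/haab054, arXiv:2009.08969v2 [Lichtman2020] (page/chunk references below are to the
held copy `paper:arxiv-2009.08969`).  Everything in this file is PROVED; it introduces no definition and
no named fact.

## Why `Lichtman2020_liouvilleMeanSquare` is NOT discharged here

The fact renders Proposition 3.4 with the PRINTED typical set `S = S(X,A,δ)` of (2.3)–(2.4), whose first
interval is `[P₁, Q₁] = [(log X)^{33A}, H/(log X)^{4A}]` (`lichtmanTypical`).  In print Proposition 3.4
follows from Proposition 5.1 (p. 14), and the printed proof of Proposition 5.1 ("Bound for `E₁`", p. 15)
sums a geometric series as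
`E₁ ≪ V log Q₁ · P₁^{-2α}/(1 − e^{−2α/V}) · (Q₁T/Y + 1) ≪ (log X)^{1−6B/5}(Q₁T/Y + 1)`, "noting
`V/(1 − e^{−2α/V}) = O(1)`" (`V = P₁^{1/3} = (log X)^B`, `B = 11A`, `α = 1/5`).  Since `1 − e^{−x} ≤ x`,
in fact `V/(1 − e^{−2α/V}) ≥ V²/(2α)`, so the display only gives `E₁ ≪ V² P₁^{−2α} log Q₁ (…)/α
= O((log X)^{2B+1−6B/5})(…)`, which saves nothing.  With the printed `P₁` no choice of `V` and `α` in the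
printed architecture works: the edge term `(T/X + 1)/V` of Lemma 4.7 forces `V ≥ (log X)^{10A}`, the
count of the well-spaced set `𝒲` through Lemma 4.4 forces `α < 1/4`, and then
`V² P₁^{−2α} ≥ (log X)^{20A − 16.5A}` is not small.  (Remark on the book-keeping of p. 14: the loss
`Q₁/h₁ ≤ W` only multiplies the term `V²(T/Y)Q₁^{1−2α}` coming from the `T`-part of Lemma 4.1, which at
`T = Y/h₁` is `≤ V² W Q₁^{−2α}`, and `Q₁^{−2α} = (log X)^{−2α(ψ(X)−4A)}` beats every fixed power of
`log X`; so for Proposition 3.4 a version of Proposition 5.1 with `(T/Y + 1)(log X)^{−10A}` in place of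
`(Q₁T/Y + 1)(log X)^{−11A}` would suffice, whence the exponent `10A` above — still out of reach for
`P₁ = (log X)^{33A}`, the Matomäki–Radziwiłł architecture saving at most about `P₁^{−1/6}`.)
`MoebiusShiftedPrimesTypical.lean`
records this gap and the repair used by the tree: the paper's argument is correct verbatim along the
sets `S_c = lichtmanTypicalWith c` with first exponent `cA`, `c ≥ 100`, and no step of §§2–5 uses an
upper bound for `P₁` other than `P₁ ≤ Q₁`, so Theorem 1.1 is unaffected.  The corrected statement of
Proposition 3.4 is the tree's named fact `Lichtman2020_liouvilleMeanSquareWith`; the printed-parameter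
statement `Lichtman2020_liouvilleMeanSquare` is left as a named fact (it is not known to be false; a proof
would need a separation of variables in Lemma 4.7 with an edge error far below `1/V`, which is not in
print).

## Content (all proved)

* `Lichtman2020_dirichletMeanValueWith_of_khale`, `Lichtman2020_liouvilleMeanSquareWith_of_khale`,
  `Lichtman2020_majorArcEstimateWith_of_khale`, `Lichtman2020_keyFourierEstimateWith_of_khale` — the
  corrected Proposition 5.1, Proposition 3.4, Proposition 3.2 and Theorem 2.2 along `S_c` (`c ≥ 100`)
  from ONE printed theorem not proved in the tree, Khale's explicit Vinogradov–Korobov zero-free region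
  for Dirichlet `L`-functions (`Literature.NumberTheory.LFunctions.Khale2024_zeroFreeRegion`), every
  other input being proved in the tree: Lemma 4.5 ⇐ Khale
  (`Lichtman2020.PrimeCharSum.Lichtman2020_primeCharacterSum_of_khale`), Lemma 4.8
  (`Lichtman2020_liouvilleCharacterSifted_holds`), Prop 5.1_c ⇐ 4.5
  (`Lichtman2020_dirichletMeanValueWith_of_primeCharacterSum`), Prop 3.4_c ⇐ 5.1_c + 4.8
  (`Lichtman2020_liouvilleMeanSquareWith_of_dirichletMeanValueWith`), Prop 3.2_c ⇐ 3.4_c and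
  Thm 2.2_c ⇐ 3.1_c + 3.2_c (`MoebiusShiftedPrimesArcsWith.lean`), Prop 3.1_c
  (`Lichtman2020_minorArcEstimateWith_holds`).
* `Lichtman2020_dirichletMeanValueWith_of_vk`, `Lichtman2020_liouvilleMeanSquareWith_of_vk`,
  `Lichtman2020_majorArcEstimateWith_of_vk`, `Lichtman2020_keyFourierEstimateWith_of_vk` (and the
  `…_of_exists_vk` form of the second) — the same four corrected statements from ANY Vinogradov–Korobov
  region for Dirichlet `L`-functions, `HasVKZeroFreeRegion c T₀` with `c > 0` and any starting height `T₀`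
  (the inexplicit interface of `VinogradovKorobovDirichlet.lean`; Khale's Theorem 1.1 is the instance
  `HasVKZeroFreeRegion (1/61.5) 10`, `hasVKZeroFreeRegion_of_khale`, and the printed inexplicit region,
  Khale (1.4) = Montgomery, *Ten lectures*, p. 176, reads `∃ c > 0, HasVKZeroFreeRegion c 10`), through
  `Lichtman2020.PrimeCharSum.Lichtman2020_primeCharacterSum_of_vk`.  So the discharge
  `Lichtman2020_liouvilleMeanSquareWith_holds` is ONE term as soon as either form of the region is proved in
  the tree: `Lichtman2020_liouvilleMeanSquareWith_of_khale Khale2024_zeroFreeRegion_holds`, or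
  `Lichtman2020_liouvilleMeanSquareWith_of_vk hc hVK`.
* `Lichtman2020.sq_div_le_div_one_sub_exp` — the elementary inequality `V²/(2α) ≤ V/(1 − e^{−2α/V})`
  behind the gap described above.
* `Lichtman2020.filter_lichtmanTypicalWith_thirtyThree`, `Lichtman2020_liouvilleMeanSquare_iff_typicalWith`,
  `Lichtman2020_liouvilleMeanSquare_of_forall_ge_thirtyThree`
  — the printed-parameter fact is, verbatim, the `c = 33` instance of the body of
  `Lichtman2020_liouvilleMeanSquareWith` (which quantifies over `c ≥ 100`): the two statements differ
  exactly in the first exponent of the typical set.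

## References

* J. D. Lichtman, arXiv:2009.08969v2: Proposition 3.4 p. 10; "Proof of Proposition 3.4 from
  Proposition 5.1" p. 14; Proposition 5.1 and its proof, (5.7)–(5.12), pp. 14–15. [Lichtman2020]
* T. Khale, *An explicit Vinogradov–Korobov zero-free region for Dirichlet L-functions*, Q. J. Math. 75
  (2024) 299–332, Theorem 1.1. [Khale2024]
* K. Matomäki, M. Radziwiłł, Ann. of Math. (2) 183 (2016) 1015–1056, Lemma 12 and §8 (the
  architecture and its `P₁^{−1/6+η}` saving). [MatomakiRadziwillAnnals2016]
-/

namespace Literature.NumberTheory.Sieve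

open Filter Finset MeasureTheory Complex
open Literature.NumberTheory.LFunctions (Khale2024_zeroFreeRegion)

/-! ### The corrected chain along `S_c`, `c ≥ 100`, from Khale's theorem alone -/

/-- **Lichtman 2020, Proposition 5.1 along `S_c` (`c ≥ 100`), from Khale's Theorem 1.1 alone**:
`Khale2024_zeroFreeRegion → Lichtman2020_dirichletMeanValueWith` (Lemma 4.5 from Khale, then
`Lichtman2020_dirichletMeanValueWith_of_primeCharacterSum`).
[cite: Lichtman2020, Proposition 5.1] -/
theorem Lichtman2020_dirichletMeanValueWith_of_khale (hK : Khale2024_zeroFreeRegion) :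
    Lichtman2020_dirichletMeanValueWith :=
  Lichtman2020_dirichletMeanValueWith_of_primeCharacterSum
    (Lichtman2020.PrimeCharSum.Lichtman2020_primeCharacterSum_of_khale hK)

/-- **Lichtman 2020, Proposition 3.4 along `S_c` (`c ≥ 100`) — the corrected form of the named fact
`Lichtman2020_liouvilleMeanSquare` — from Khale's Theorem 1.1 alone**:
`Khale2024_zeroFreeRegion → Lichtman2020_liouvilleMeanSquareWith`, through Proposition 5.1_c
(`Lichtman2020_dirichletMeanValueWith_of_khale`) and the proved Lemma 4.8
(`Lichtman2020_liouvilleCharacterSifted_holds`).  After this theorem the trust base of the corrected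
Proposition 3.4 is exactly the Vinogradov–Korobov zero-free region for Dirichlet `L`-functions.
[cite: Lichtman2020, Proposition 3.4] -/
theorem Lichtman2020_liouvilleMeanSquareWith_of_khale (hK : Khale2024_zeroFreeRegion) :
    Lichtman2020_liouvilleMeanSquareWith :=
  Lichtman2020_liouvilleMeanSquareWith_of_dirichletMeanValueWith
    (Lichtman2020_dirichletMeanValueWith_of_khale hK) Lichtman2020_liouvilleCharacterSifted_holds

/-- **Lichtman 2020, Proposition 3.2 (major arcs) along `S_c` (`c ≥ 100`), from Khale's Theorem 1.1
alone** (`Lichtman2020_majorArcEstimateWith_of_liouvilleMeanSquareWith` fed with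
`Lichtman2020_liouvilleMeanSquareWith_of_khale`). [cite: Lichtman2020, Proposition 3.2] -/
theorem Lichtman2020_majorArcEstimateWith_of_khale (hK : Khale2024_zeroFreeRegion) :
    Lichtman2020_majorArcEstimateWith :=
  Lichtman2020_majorArcEstimateWith_of_liouvilleMeanSquareWith
    (Lichtman2020_liouvilleMeanSquareWith_of_khale hK)

/-- **Lichtman 2020, Theorem 2.2 (key Fourier estimate) along `S_c` (`c ≥ 100`), from Khale's
Theorem 1.1 alone** (minor arcs `Lichtman2020_minorArcEstimateWith_holds`, major arcs through
`Lichtman2020_liouvilleMeanSquareWith_of_khale`). [cite: Lichtman2020, Theorem 2.2] -/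
theorem Lichtman2020_keyFourierEstimateWith_of_khale (hK : Khale2024_zeroFreeRegion) :
    Lichtman2020_keyFourierEstimateWith :=
  Lichtman2020_keyFourierEstimateWith_of_minorArc_of_liouvilleMeanSquareWith
    Lichtman2020_minorArcEstimateWith_holds (Lichtman2020_liouvilleMeanSquareWith_of_khale hK)

/-! ### The elementary inequality behind the gap -/

/-- For `V, α > 0`: `V²/(2α) ≤ V/(1 − e^{−2α/V})` (because `1 − e^{−x} ≤ x`).  In particular
`V/(1 − e^{−2α/V}) → ∞` as `V → ∞`, contrary to the remark "`V/(1 − e^{−2α/V}) = O(1)`" after (5.9),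
p. 15 of the paper, on which the printed bound for `E₁` rests (module docstring). [folklore] -/
theorem Lichtman2020.sq_div_le_div_one_sub_exp {V α : ℝ} (hV : 0 < V) (hα : 0 < α) :
    V ^ 2 / (2 * α) ≤ V / (1 - Real.exp (-(2 * α / V))) := by
  have hx : 0 < 2 * α / V := by positivity
  have h1 : 1 - Real.exp (-(2 * α / V)) ≤ 2 * α / V := by
    have := Real.add_one_le_exp (-(2 * α / V))
    linarith
  have h2 : 0 < 1 - Real.exp (-(2 * α / V)) := by
    have : Real.exp (-(2 * α / V)) < 1 := Real.exp_lt_one_iff.mpr (by linarith)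
    linarith
  have hV0 : V ≠ 0 := hV.ne'
  have hα0 : α ≠ 0 := hα.ne'
  calc V ^ 2 / (2 * α) = V / (2 * α / V) := by field_simp
    _ ≤ V / (1 - Real.exp (-(2 * α / V))) := div_le_div_of_nonneg_left hV.le h2 h1

/-! ### The printed-parameter fact is the `c = 33` instance of the corrected family -/

/-- Filtering by the printed typical set is filtering by `lichtmanTypicalWith 33`
(`lichtmanTypicalWith_thirtyThree` under `Finset.filter`, whatever the decidability instances).
[cite: Lichtman2020, (2.3)–(2.4)] -/
theorem Lichtman2020.filter_lichtmanTypicalWith_thirtyThree (X A δ Hx : ℝ) (s : Finset ℕ) :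
    s.filter (lichtmanTypicalWith 33 X A δ Hx) = s.filter (lichtmanTypical X A δ Hx) :=
  Finset.filter_congr fun _ _ => Iff.rfl

/-- **`Lichtman2020_liouvilleMeanSquare` is verbatim the `c = 33` instance of the body of
`Lichtman2020_liouvilleMeanSquareWith`.**  The named fact of `MoebiusShiftedPrimesMajorArcs.lean`
(Proposition 3.4 with the printed first exponent `33A`) and the corrected named fact of
`MoebiusShiftedPrimesTypical.lean` (the same body for every `c ≥ 100`) differ exactly in the exponent
`c`; see the module docstring for why only the latter is proved (from Khale's theorem,
`Lichtman2020_liouvilleMeanSquareWith_of_khale`). [cite: Lichtman2020, Proposition 3.4] -/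
theorem Lichtman2020_liouvilleMeanSquare_iff_typicalWith :
    Lichtman2020_liouvilleMeanSquare ↔
      ∀ A : ℝ, 5 < A → ∀ δ : ℝ, 0 < δ → ∀ H : ℕ → ℕ,
        Tendsto (fun X : ℕ => Real.log (H X) / Real.log (Real.log X)) atTop atTop →
        (∀ᶠ X : ℕ in atTop, (H X : ℝ) ≤ Real.exp (Real.log X ^ (2 / 3 : ℝ))) →
        ∃ C : ℝ, ∀ᶠ X : ℕ in atTop, ∀ q : ℕ, 1 ≤ q → (q : ℝ) ≤ Real.log X ^ A →
          ∀ χ : DirichletCharacter ℂ q, ∀ h : ℕ,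
            (H X : ℝ) / Real.log X ^ (5 * A) ≤ h → h ≤ H X →
            ∀ Y : ℝ, (X : ℝ) / Real.log X ^ (6 * A) ≤ Y → Y ≤ X →
              ∫ x in Y..2 * Y,
                  ‖∑ m ∈ (Icc ⌈x⌉₊ ⌊x + h⌋₊).filter (lichtmanTypicalWith 33 X A δ (H X)),
                      ((ArithmeticFunction.liouville m : ℤ) : ℂ) * χ (m : ZMod q)‖ ^ 2
                ≤ C * ((h : ℝ) ^ 2 * Y / Real.log X ^ (10 * A)) := by
  simp only [Lichtman2020_liouvilleMeanSquare, Lichtman2020.filter_lichtmanTypicalWith_thirtyThree]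

/-- The corrected family at `c = 33` would give the printed-parameter fact: if the body of
`Lichtman2020_liouvilleMeanSquareWith` held for every `c ≥ 33` (rather than every `c ≥ 100`), then
`Lichtman2020_liouvilleMeanSquare` would follow.  (Recorded to make the logical relation between the two
named facts explicit; the hypothesis is NOT proved in the tree.) [cite: Lichtman2020, Proposition 3.4] -/
theorem Lichtman2020_liouvilleMeanSquare_of_forall_ge_thirtyThree
    (h : ∀ c : ℝ, 33 ≤ c → ∀ A : ℝ, 5 < A → ∀ δ : ℝ, 0 < δ → ∀ H : ℕ → ℕ,
      Tendsto (fun X : ℕ => Real.log (H X) / Real.log (Real.log X)) atTop atTop →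
      (∀ᶠ X : ℕ in atTop, (H X : ℝ) ≤ Real.exp (Real.log X ^ (2 / 3 : ℝ))) →
      ∃ C : ℝ, ∀ᶠ X : ℕ in atTop, ∀ q : ℕ, 1 ≤ q → (q : ℝ) ≤ Real.log X ^ A →
        ∀ χ : DirichletCharacter ℂ q, ∀ h : ℕ,
          (H X : ℝ) / Real.log X ^ (5 * A) ≤ h → h ≤ H X →
          ∀ Y : ℝ, (X : ℝ) / Real.log X ^ (6 * A) ≤ Y → Y ≤ X →
            ∫ x in Y..2 * Y,
                ‖∑ m ∈ (Icc ⌈x⌉₊ ⌊x + h⌋₊).filter (lichtmanTypicalWith c X A δ (H X)),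
                    ((ArithmeticFunction.liouville m : ℤ) : ℂ) * χ (m : ZMod q)‖ ^ 2
              ≤ C * ((h : ℝ) ^ 2 * Y / Real.log X ^ (10 * A))) :
    Lichtman2020_liouvilleMeanSquare :=
  Lichtman2020_liouvilleMeanSquare_iff_typicalWith.2 (h 33 le_rfl)

/-! ### The corrected chain along `S_c`, `c ≥ 100`, from ANY Vinogradov–Korobov region -/

section OfVK

open Literature.NumberTheory.LFunctions (HasVKZeroFreeRegion)

/-- **Lichtman 2020, Proposition 5.1 along `S_c` (`c ≥ 100`), from any Vinogradov–Korobov region for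
Dirichlet `L`-functions** `HasVKZeroFreeRegion c T₀` (`c > 0`, any starting height `T₀`): Lemma 4.5 by
`Lichtman2020.PrimeCharSum.Lichtman2020_primeCharacterSum_of_vk`, then
`Lichtman2020_dirichletMeanValueWith_of_primeCharacterSum`.  The Khale form
`Lichtman2020_dirichletMeanValueWith_of_khale` is the instance `c = 1/61.5`, `T₀ = 10`
(`hasVKZeroFreeRegion_of_khale`). [cite: Lichtman2020, Proposition 5.1] -/
theorem Lichtman2020_dirichletMeanValueWith_of_vk {cVK TVK : ℝ} (hcVK : 0 < cVK)
    (hVK : HasVKZeroFreeRegion cVK TVK) : Lichtman2020_dirichletMeanValueWith :=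
  Lichtman2020_dirichletMeanValueWith_of_primeCharacterSum
    (Lichtman2020.PrimeCharSum.Lichtman2020_primeCharacterSum_of_vk hcVK hVK)

/-- **Lichtman 2020, Proposition 3.4 along `S_c` (`c ≥ 100`) — the named fact
`Lichtman2020_liouvilleMeanSquareWith` — from any Vinogradov–Korobov region for Dirichlet `L`-functions**
`HasVKZeroFreeRegion c T₀` (`c > 0`): Proposition 5.1_c (`Lichtman2020_dirichletMeanValueWith_of_vk`) and
the proved Lemma 4.8 (`Lichtman2020_liouvilleCharacterSifted_holds`) fed to
`Lichtman2020_liouvilleMeanSquareWith_of_dirichletMeanValueWith`.  Hence an inexplicit proof of the region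
(Vinogradov's method with unspecified constants) discharges the fact exactly as Khale's explicit theorem
does (`Lichtman2020_liouvilleMeanSquareWith_of_khale`). [cite: Lichtman2020, Proposition 3.4] -/
theorem Lichtman2020_liouvilleMeanSquareWith_of_vk {cVK TVK : ℝ} (hcVK : 0 < cVK)
    (hVK : HasVKZeroFreeRegion cVK TVK) : Lichtman2020_liouvilleMeanSquareWith :=
  Lichtman2020_liouvilleMeanSquareWith_of_dirichletMeanValueWith
    (Lichtman2020_dirichletMeanValueWith_of_vk hcVK hVK) Lichtman2020_liouvilleCharacterSifted_holds

/-- **Proposition 3.4 along `S_c` from the printed (inexplicit) Vinogradov–Korobov region**: if SOME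
region `HasVKZeroFreeRegion c T₀` with `c > 0` holds (Khale (1.4) = Montgomery, *Ten lectures*, p. 176,
is the case `T₀ = 10`), then `Lichtman2020_liouvilleMeanSquareWith`.
[cite: Lichtman2020, Proposition 3.4] -/
theorem Lichtman2020_liouvilleMeanSquareWith_of_exists_vk
    (h : ∃ c T₀ : ℝ, 0 < c ∧ HasVKZeroFreeRegion c T₀) : Lichtman2020_liouvilleMeanSquareWith := by
  obtain ⟨c, T₀, hc, hVK⟩ := h
  exact Lichtman2020_liouvilleMeanSquareWith_of_vk hc hVK

/-- **Lichtman 2020, Proposition 3.2 (major arcs) along `S_c` (`c ≥ 100`), from any Vinogradov–Korobov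
region for Dirichlet `L`-functions** (`Lichtman2020_majorArcEstimateWith_of_liouvilleMeanSquareWith` fed
with `Lichtman2020_liouvilleMeanSquareWith_of_vk`). [cite: Lichtman2020, Proposition 3.2] -/
theorem Lichtman2020_majorArcEstimateWith_of_vk {cVK TVK : ℝ} (hcVK : 0 < cVK)
    (hVK : HasVKZeroFreeRegion cVK TVK) : Lichtman2020_majorArcEstimateWith :=
  Lichtman2020_majorArcEstimateWith_of_liouvilleMeanSquareWith
    (Lichtman2020_liouvilleMeanSquareWith_of_vk hcVK hVK)

/-- **Lichtman 2020, Theorem 2.2 (key Fourier estimate) along `S_c` (`c ≥ 100`), from any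
Vinogradov–Korobov region for Dirichlet `L`-functions** (minor arcs `Lichtman2020_minorArcEstimateWith_holds`,
major arcs through `Lichtman2020_liouvilleMeanSquareWith_of_vk`). [cite: Lichtman2020, Theorem 2.2] -/
theorem Lichtman2020_keyFourierEstimateWith_of_vk {cVK TVK : ℝ} (hcVK : 0 < cVK)
    (hVK : HasVKZeroFreeRegion cVK TVK) : Lichtman2020_keyFourierEstimateWith :=
  Lichtman2020_keyFourierEstimateWith_of_minorArc_of_liouvilleMeanSquareWith
    Lichtman2020_minorArcEstimateWith_holds (Lichtman2020_liouvilleMeanSquareWith_of_vk hcVK hVK)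

end OfVK

end Literature.NumberTheory.Sieve
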